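import Summits.CriticalPhenomena.PercolationContinuityZ3.Theorems.PercNearOneGluingNoHeavyPcintChainMemZ3C10Check1
import Summits.CriticalPhenomena.PercolationContinuityZ3.Theorems.PercNearOneGluingNoHeavyPcintChainMemZ3C10Check2
import Summits.CriticalPhenomena.PercolationContinuityZ3.Theorems.PercNearOneGluingNoHeavyPcintChainMemZ3C10Check3
import Summits.CriticalPhenomena.PercolationContinuityZ3.Theorems.PercNearOneGluingNoHeavyPcintChainMemZ3C10Check4
import HarnessLib

/-!
# PCINT lane, kernel reduced-state B3c certificate `Z3C10` (bond, d = 3, memory τ = 10, kc = 4, 3084 state classes): the theorem `p_c^bond(ℤ^3) ≥ 0.2219`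

Cell `prim-pcint`, seat `prim-pcint-2` (gen 4); memo `run/shared/lean/prim/pcint/REDUCTIONS.md` §B3c and HANDOFF ("B3c on reduced states").
Does NOT build on p205010.  Data for `BondK.le_criticalProb_of_checkRowsC` (`…PcintChainMemKernelCert`): `p = 22190/100000`, chain
parameter `kc = 4`, `s̄ = 97507/100000` (`s̄²+p² ≥ 1`), refund `r = 102557/100000` (`s̄·r ≥ 1`, `(1-p)·r² ≤ 1`), `κ̄ = (100000²+97507²)/(2·100000²)`,
`λ = 99999/100000`; Collatz–Wielandt weights (scale 10⁹) from a power iteration (ρ ≈ 0.9998589), exact off-line max row ratio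
0.9998589458 < λ.  Generated by work/gen/gen_b3c_kernel.py (prim-pcint-2 gen 4 folder; copy in
run/shared/lean/prim/pcint/prim-pcint-2/kernel/); the kernel re-checks every row.
-/

namespace Summit.CriticalPhenomena.PercolationContinuityZ3.Theorems.Pcint

open Literature.Probability.Percolation Literature.Probability.LatticeModels

/-- Every row of the certificate passes. [folklore] -/
theorem ChainMemZ3C10.all_rows : WinK.allRange (BondK.checkRowC 10 4 3 3084 22190 102557 97507 100000 99999 100000 ChainMemZ3C10.syms ChainMemZ3C10.tree) 0 3084 = true := (WinK.allRange_split (WinK.allRange_split (WinK.allRange_split ChainMemZ3C10.file_1 ChainMemZ3C10.file_2) ChainMemZ3C10.file_3) ChainMemZ3C10.file_4)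

/-- **`p_c^bond(ℤ^3) ≥ 0.2219`** (kernel-checked reduced-state B3c certificate: `chordrand` + chain-bonus weights on the memory-`10`
dangerous-set automaton, chain parameter `kc = 4`, 3084 state classes, `decide +kernel` only). [folklore] -/
theorem criticalProb_Z3_ge_02219 : (0.2219 : ℝ) ≤ criticalProb (zdGraph 3) 0 := by
  have h := BondK.le_criticalProb_of_checkRowsC (d := 3) (τ := 10) (kc := 4) (N := 3084) (pn := 22190) (R := 102557) (S := 97507)
    (D := 100000) (lamN := 99999) (lamD := 100000) (syms := ChainMemZ3C10.syms) (t := ChainMemZ3C10.tree) (by norm_num) (by norm_num)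
    (fun c => NawK.symOfTab 3 (ChainMemZ3C10.syms.getD c [])) (NawK.syms_spec_of_valid ChainMemZ3C10.syms_valid)
    (fun i hi => WinK.of_allRange ChainMemZ3C10.all_rows (Nat.zero_le i) hi)
    (by norm_num) (by decide +kernel) (by norm_num) (by norm_num) (by norm_num) (by norm_num) (by norm_num) (by norm_num)
    (by norm_num) (by norm_num)
  have e : ((22190 : ℕ) : ℝ) / ((100000 : ℕ) : ℝ) = (0.2219 : ℝ) := by norm_num
  rw [e] at h
  exact h

end Summit.CriticalPhenomena.PercolationContinuityZ3.Theorems.Pcint
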